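import Literature.NumberTheory.GaloisRepresentations.LubinTateUnramifiedTowerIwasawaCyclic
import Literature.NumberTheory.GaloisRepresentations.LubinTateColemanTwoVariableTwistGaloisTwo
import HarnessLib

/-!
# The two-variable Coleman transform at `q = 2` along a GENERAL unramified tower `[E_m : F] = d·p^m` (`p ∤ d`):
# `Col : 𝒰_∞ ↪ (ℤ/d → 𝒪_F⟦X⟧⟦Y⟧) = 𝒪_F[ℤ/d]⟦X⟧⟦Y⟧`, injective on principal families, Frobenius powers = shift ⊗ `(1+X)^t`

De Shalit, *Iwasawa theory of elliptic curves with complex multiplication* (1987), Ch. I §3.1, §3.7–3.8 (17), Ch. III §1.3.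
`LubinTateColemanTwoVariableTransformTwo` built the transform `Col : 𝒰_∞ → 𝒪_F⟦X⟧⟦Y⟧` for a `ℤ_p`-tower (`[E_m : F] = p^m`).  The unramified
layers `K(𝔤𝔭̄^{m+1})_𝔓` of the two-variable towers have Galois group `ℤ/d × ℤ_p` over `F = K_𝔭` (a prime-to-`p` part `d` from
`(𝒪_K/𝔤)ˣ`); for such towers (`[E_m : F] = d·p^m`, `LubinTateUnramifiedTowerIwasawaCyclic`) the coordinate family `(r_{β_m})_m` of a
baseNorm-coherent family of norm-coherent units `β = (β_m ∈ 𝒰(E_m·K_π^∞))_m` (`q = |𝓀_F| = 2`, `π = 2u`) is trace-coherent, hence has,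
coefficient by coefficient in `Y`, a `ℤ/d`-tuple of transforms in `𝒪_F⟦X⟧`; altogether ONE element `Col(β) : ℤ/d → 𝒪_F⟦X⟧⟦Y⟧` of
`𝒪_F[ℤ/d]⟦X⟧⟦Y⟧ = Λ(ℤ/d × ℤ_p, 𝒪_F)⟦Y⟧`:

* ★★ `existsUnique_seriesProd_amice_of_traceCoherent` — every trace-coherent family of series has a unique transform
  `G : ℤ/d → PowerSeries (PowerSeries 𝒪_F)` (`coeff_k (G j) ≡ Σ_i a_{coeff_k r_m}(φ_m^{χ_m⁻¹(j,i)})(1+X)^i (mod ω_m)` for all `m, k, j`);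
* ★★★ `existsUnique_colemanTransformProd₂` — **the two-variable Coleman transform** of a baseNorm-coherent family exists and is unique;
  ★★ `eq_of_colemanTransformProd₂_eq` — **`Col` is injective on principal families** (`u^{[E_m:F]} ≠ 1`);
* `frobUnitBall_pow_apply`, ★★ `seriesProd_amice_frobPow` — the Frobenius power `σ₀^t` (acting on the coefficients) sends a transform `G`
  to `j ↦ C((1+X)^t)·G(j − t)`: the generator of `Gal(E_∞/F) ≅ ℤ/d × ℤ_p` acts on `𝒪_F[ℤ/d]⟦X⟧⟦Y⟧` as `[1]·(1+X)` — the unramified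
  variable `X` together with the regular representation of the prime-to-`p` part.

Everything PROVED (0 sorry, no named facts, no new definitions).  The Galois equivariance in the Lubin–Tate direction and for arbitrary
`σ̃ ∈ Γ_F` is `LubinTateColemanTwoVariableGaloisCyclicTwo`.

## References

* E. de Shalit, *Iwasawa theory of elliptic curves with complex multiplication* (1987), Ch. I §3.1, §3.7–3.8 (17); Ch. III §1.3. [deShalit1987]
-/

noncomputable section

open scoped PowerSeries.WithPiTopology

namespace Literature.NumberTheory.GaloisRepresentations

section TwoVariableTransformCyclicTwo

open GaloisRepresentations.IsNonarchimedeanLocalField LubinTate ValuativeRel Field Finset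
open Literature.NumberTheory.EllipticCurves.IwasawaOmega

variable {F : Type} [Field F] [ValuativeRel F] [TopologicalSpace F] [IsNonarchimedeanLocalField F]

attribute [local instance] ltNormUniformSpace ltNormIsUniformAddGroup rk1 nF nE fintypeResidueField

variable (p : ℕ) [hp : Fact p.Prime] (d : ℕ) [NeZero d] (hd : d.Coprime p)
variable {π : 𝒪[F]} (hπ : (valuation F).IsUniformizer (π : F))
variable (E : ℕ → IntermediateField F (AlgebraicClosure F)) [∀ m, FiniteDimensional F (E m)] [∀ m, Normal F (E m)]
  [∀ m, IsGalois F (E m)] (hmono : Monotone E) (hE : ∀ m, E m ≤ maxUnramified F) (hdeg : ∀ m, Module.finrank F (E m) = d * p ^ m)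
  {σ₀ : absoluteGaloisGroup F} (hσ₀ : IsAbsArithFrob σ₀)

/-! ### Trace-coherent families of series ↦ `ℤ/d → PowerSeries (PowerSeries 𝒪_F)` -/

include hE hdeg hσ₀ in
/-- ★★ **The transform of a trace-coherent family of SERIES** (coefficientwise `existsUnique_amiceProd_of_traceCoherent`): for
trace-coherent generators `θ` and series `r_m ∈ 𝒪_{E_m}⟦Y⟧` with `Tr r_{m+1} = r_m` coefficientwise, there is a unique
`G : ℤ/d → PowerSeries (PowerSeries 𝒪_F)` with `coeff_k (G j) ≡ Σ_{i ∈ ℤ/p^m} a_{coeff_k r_m}(φ_m^{χ_m⁻¹(j,i)})·(1+X)^i (mod ω_m)` for all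
`m, k, j`. [cite: deShalit1987, Ch. I §3.8 (17)] -/
theorem existsUnique_seriesProd_amice_of_traceCoherent [IsAdicComplete (Ideal.span {(p : 𝒪[F])}) 𝒪[F]] {θ : ∀ m, unitBall (E m)}
    (hθ : ∀ m, IsIntegralNormalGen (E m) (θ m)) (hcoh : ∀ m, unitBallTrace (hmono (Nat.le_succ m)) (θ (m + 1)) = θ m)
    (r : ∀ m, PowerSeries (unitBall (E m)))
    (hr : ∀ m k, unitBallTrace (hmono (Nat.le_succ m)) (PowerSeries.coeff k (r (m + 1))) = PowerSeries.coeff k (r m)) :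
    ∃! G : ZMod d → PowerSeries (PowerSeries 𝒪[F]), ∀ m k (j : ZMod d), ((1 + PowerSeries.X : PowerSeries 𝒪[F]) ^ p ^ m - 1) ∣
      PowerSeries.coeff k (G j) - ∑ i : ZMod (p ^ m), PowerSeries.C ((hθ m).basis.repr (PowerSeries.coeff k (r m))
        (((absoluteGaloisGroup.toAlgEquiv F σ₀).restrictNormal (E m)) ^ ((ZMod.chineseRemainder (hd.pow_right m)).symm (j, i)).val)) *
          (1 + PowerSeries.X) ^ i.val := by
  have hk := fun k => existsUnique_amiceProd_of_traceCoherent p d hd E hmono hE hdeg hσ₀ hθ hcoh (fun m => PowerSeries.coeff k (r m))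
    (fun m => hr m k)
  choose g hg using fun k => (hk k).exists
  refine ⟨fun j => PowerSeries.mk fun k => g k j, fun m k j => by rw [PowerSeries.coeff_mk]; exact hg k m j, fun G' hG' => funext fun j =>
    PowerSeries.ext fun k => ?_⟩
  rw [PowerSeries.coeff_mk]
  exact congrFun ((hk k).unique (fun m j' => hG' m k j') (hg k)) j

/-! ### The two-variable Coleman transform of a norm-coherent unit of the tower -/

variable (hq : residueFieldCard F = 2)

include hdeg in
/-- ★★★ **The two-variable Coleman transform exists and is unique** along a general unramified tower: for a baseNorm-coherent family
`β = (β_m ∈ 𝒰(E_m·K_π^∞))_m` there is a unique `Col(β) : ℤ/d → PowerSeries (PowerSeries 𝒪_F)` with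
`coeff_k (Col(β) j) ≡ Σ_i a_{coeff_k r_{β_m}}(φ_m^{χ_m⁻¹(j,i)})(1+X)^i (mod ω_m)` for all `m, k, j` (the coordinates `r_{β_m}` are
trace-coherent by `unitBallTrace_coeff_relUnitCoordTwo`). [cite: deShalit1987, Ch. I §3.7–3.8 (17); Ch. III §1.3] -/
theorem existsUnique_colemanTransformProd₂ [IsAdicComplete (Ideal.span {(p : 𝒪[F])}) 𝒪[F]] {θ : ∀ m, unitBall (E m)}
    (hθ : ∀ m, IsIntegralNormalGen (E m) (θ m)) (hcoh : ∀ m, unitBallTrace (hmono (Nat.le_succ m)) (θ (m + 1)) = θ m)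
    (u : (LTCoeff F)ˣ) (hu : LTCoeff.of F π = residueFieldCard F * u) {β : ∀ m, RelNormCoherentUnits hπ (E m)}
    (hβ : ∀ m, (β (m + 1)).baseNorm hπ (hmono (Nat.le_succ m)) = β m) :
    ∃! G : ZMod d → PowerSeries (PowerSeries 𝒪[F]), ∀ m k (j : ZMod d), ((1 + PowerSeries.X : PowerSeries 𝒪[F]) ^ p ^ m - 1) ∣
      PowerSeries.coeff k (G j) - ∑ i : ZMod (p ^ m), PowerSeries.C ((hθ m).basis.repr
        (PowerSeries.coeff k (relUnitCoordTwo hπ (E m) hq (hE m) hσ₀ u hu (β m)))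
        (((absoluteGaloisGroup.toAlgEquiv F σ₀).restrictNormal (E m)) ^ ((ZMod.chineseRemainder (hd.pow_right m)).symm (j, i)).val)) *
          (1 + PowerSeries.X) ^ i.val := by
  refine existsUnique_seriesProd_amice_of_traceCoherent p d hd E hmono hE hdeg hσ₀ hθ hcoh _ fun m k => ?_
  rw [unitBallTrace_coeff_relUnitCoordTwo hπ hq hσ₀ (hmono (Nat.le_succ m)) (hE (m + 1)) u hu (β (m + 1)) k, hβ]

include hE hdeg hσ₀ in
/-- **The congruences at one level determine the coordinate vector**: if two elements `y, y' ∈ 𝒪_{E_m}` satisfy the CRT congruences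
against the same `ℤ/d`-tuple `f`, then `y = y'` (`𝒪_F⟦X⟧/(ω_m) ≅ 𝒪_F[ℤ/p^m]` by `existsUnique_omega_dvd_sub_amice`, for each `j`, and
`i ↦ φ_m^{χ_m⁻¹(j,i)}` covers `Gal(E_m/F)` as `j` varies). [cite: deShalit1987, Ch. I §3.8 (17)] -/
theorem eq_of_forall_omega_dvd_sub_sum [IsAdicComplete (Ideal.span {(p : 𝒪[F])}) 𝒪[F]] (hI : Ideal.span {(p : 𝒪[F])} ≠ ⊤) {m : ℕ}
    {θ : unitBall (E m)} (hθ : IsIntegralNormalGen (E m) θ) (f : ZMod d → PowerSeries 𝒪[F]) {y y' : unitBall (E m)}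
    (hy : ∀ j : ZMod d, ((1 + PowerSeries.X : PowerSeries 𝒪[F]) ^ p ^ m - 1) ∣
      f j - ∑ i : ZMod (p ^ m), PowerSeries.C (hθ.basis.repr y
        (((absoluteGaloisGroup.toAlgEquiv F σ₀).restrictNormal (E m)) ^ ((ZMod.chineseRemainder (hd.pow_right m)).symm (j, i)).val)) *
          (1 + PowerSeries.X) ^ i.val)
    (hy' : ∀ j : ZMod d, ((1 + PowerSeries.X : PowerSeries 𝒪[F]) ^ p ^ m - 1) ∣
      f j - ∑ i : ZMod (p ^ m), PowerSeries.C (hθ.basis.repr y'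
        (((absoluteGaloisGroup.toAlgEquiv F σ₀).restrictNormal (E m)) ^ ((ZMod.chineseRemainder (hd.pow_right m)).symm (j, i)).val)) *
          (1 + PowerSeries.X) ^ i.val) :
    y = y' := by
  refine hθ.eq_of_repr_eq fun ρ => ?_
  obtain ⟨n, rfl⟩ := (frobPow_bijective_cyclic p d E hE hdeg hσ₀ m).2 ρ
  obtain ⟨⟨j, i⟩, rfl⟩ := (ZMod.chineseRemainder (hd.pow_right m)).symm.surjective n
  have hab := (existsUnique_omega_dvd_sub_amice p hI m (f j)).unique (hy j) (hy' j)
  exact congrFun hab i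

include hdeg in
/-- ★★ **The two-variable Coleman transform is injective on principal families** (`char F = 0`, `u^{[E_m:F]} ≠ 1` for all `m`): two
baseNorm-coherent families of principal units with the same transform are equal (the transform determines the coordinate series levelwise,
`eq_of_forall_omega_dvd_sub_sum`, and these determine `β` by `eq_of_forall_relUnitCoordTwo_eq`). [cite: deShalit1987, Ch. I §3.7–3.8 (17)] -/
theorem eq_of_colemanTransformProd₂_eq [CharZero F] [IsAdicComplete (Ideal.span {(p : 𝒪[F])}) 𝒪[F]] (hI : Ideal.span {(p : 𝒪[F])} ≠ ⊤)
    {θ : ∀ m, unitBall (E m)} (hθ : ∀ m, IsIntegralNormalGen (E m) (θ m)) (u : (LTCoeff F)ˣ) (hu : LTCoeff.of F π = residueFieldCard F * u)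
    (hud : ∀ m, (u : LTCoeff F) ^ Module.finrank F (E m) ≠ 1) {β β' : ∀ m, RelNormCoherentUnits hπ (E m)}
    (hβ1 : ∀ m, ‖(((β m).val 0 : unitBall (E m ⊔ ltField π 0 : IntermediateField F (AlgebraicClosure F))) :
      (E m ⊔ ltField π 0 : IntermediateField F (AlgebraicClosure F))) - 1‖ < 1)
    (hβ'1 : ∀ m, ‖(((β' m).val 0 : unitBall (E m ⊔ ltField π 0 : IntermediateField F (AlgebraicClosure F))) :
      (E m ⊔ ltField π 0 : IntermediateField F (AlgebraicClosure F))) - 1‖ < 1)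
    (G : ZMod d → PowerSeries (PowerSeries 𝒪[F]))
    (hG : ∀ m k (j : ZMod d), ((1 + PowerSeries.X : PowerSeries 𝒪[F]) ^ p ^ m - 1) ∣
      PowerSeries.coeff k (G j) - ∑ i : ZMod (p ^ m), PowerSeries.C ((hθ m).basis.repr
        (PowerSeries.coeff k (relUnitCoordTwo hπ (E m) hq (hE m) hσ₀ u hu (β m)))
        (((absoluteGaloisGroup.toAlgEquiv F σ₀).restrictNormal (E m)) ^ ((ZMod.chineseRemainder (hd.pow_right m)).symm (j, i)).val)) *
          (1 + PowerSeries.X) ^ i.val)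
    (hG' : ∀ m k (j : ZMod d), ((1 + PowerSeries.X : PowerSeries 𝒪[F]) ^ p ^ m - 1) ∣
      PowerSeries.coeff k (G j) - ∑ i : ZMod (p ^ m), PowerSeries.C ((hθ m).basis.repr
        (PowerSeries.coeff k (relUnitCoordTwo hπ (E m) hq (hE m) hσ₀ u hu (β' m)))
        (((absoluteGaloisGroup.toAlgEquiv F σ₀).restrictNormal (E m)) ^ ((ZMod.chineseRemainder (hd.pow_right m)).symm (j, i)).val)) *
          (1 + PowerSeries.X) ^ i.val) :
    β = β' :=
  eq_of_forall_relUnitCoordTwo_eq hπ hq hσ₀ E hE u hu hud hβ1 hβ'1 fun m => PowerSeries.ext fun k =>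
    eq_of_forall_omega_dvd_sub_sum p d hd E hE hdeg hσ₀ hI (hθ m) (fun j => PowerSeries.coeff k (G j)) (fun j => hG m k j)
      (fun j => hG' m k j)

/-! ### Frobenius powers: shift ⊗ `C((1+X)^t)` -/

/-- `φ^t` on `𝒪_E` as a power of the ring endomorphism `frobUnitBall` is `unitBallEquiv` of the power `(σ₀|_E)^t`.
[cite: SerreLocalFields1979, Ch. IV §4 Prop. 16] -/
theorem frobUnitBall_pow_apply (E' : IntermediateField F (AlgebraicClosure F)) [FiniteDimensional F E'] [Normal F E']
    (σ₀' : absoluteGaloisGroup F) (t : ℕ)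
    (c : unitBall E') :
    ((frobUnitBall E' σ₀' : unitBall E' →+* unitBall E') ^ t) c =
      unitBallEquiv E' (((absoluteGaloisGroup.toAlgEquiv F σ₀').restrictNormal E') ^ t) c := by
  induction t with
  | zero =>
    rw [pow_zero, RingHom.one_def, RingHom.id_apply, pow_zero]
    exact Subtype.ext (by rw [coe_unitBallEquiv, AlgEquiv.one_apply])
  | succ t ih =>
    rw [pow_succ', RingHom.mul_def, RingHom.comp_apply, ih, pow_succ', unitBallEquiv_mul_apply]
    rfl

include hE hdeg hσ₀ in
/-- ★★ **The Frobenius power acts as shift ⊗ `C((1+X)^t)`** (coefficientwise `amiceProd_frobPow`): if `G` is the transform of the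
trace-coherent family of series `r`, then `j ↦ C((1 + X)^t)·G(j − t)` is the transform of `((r_m)^{φ_m^t})_m` (`φ_m^t` on coefficients).
So on `𝒪_F[ℤ/d]⟦X⟧⟦Y⟧` the generator `φ` of `Gal(E_∞/F) ≅ ℤ/d × ℤ_p` acts as `[1]·(1+X)`: the inner variable `X` is its `ℤ_p`-part minus
one, and its `ℤ/d`-part acts through the regular representation. [cite: deShalit1987, Ch. I §3.1, §3.8 (17)] -/
theorem seriesProd_amice_frobPow {θ : ∀ m, unitBall (E m)} (hθ : ∀ m, IsIntegralNormalGen (E m) (θ m))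
    (r : ∀ m, PowerSeries (unitBall (E m))) (G : ZMod d → PowerSeries (PowerSeries 𝒪[F]))
    (hG : ∀ m k (j : ZMod d), ((1 + PowerSeries.X : PowerSeries 𝒪[F]) ^ p ^ m - 1) ∣
      PowerSeries.coeff k (G j) - ∑ i : ZMod (p ^ m), PowerSeries.C ((hθ m).basis.repr (PowerSeries.coeff k (r m))
        (((absoluteGaloisGroup.toAlgEquiv F σ₀).restrictNormal (E m)) ^ ((ZMod.chineseRemainder (hd.pow_right m)).symm (j, i)).val)) *
          (1 + PowerSeries.X) ^ i.val) (t m k : ℕ) (j : ZMod d) :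
    ((1 + PowerSeries.X : PowerSeries 𝒪[F]) ^ p ^ m - 1) ∣
      PowerSeries.coeff k (PowerSeries.C ((1 + PowerSeries.X : PowerSeries 𝒪[F]) ^ t) * G (j - t)) -
        ∑ i : ZMod (p ^ m), PowerSeries.C ((hθ m).basis.repr
          (PowerSeries.coeff k (PowerSeries.map ((frobUnitBall (E m) σ₀ : unitBall (E m) →+* unitBall (E m)) ^ t) (r m)))
          (((absoluteGaloisGroup.toAlgEquiv F σ₀).restrictNormal (E m)) ^ ((ZMod.chineseRemainder (hd.pow_right m)).symm (j, i)).val)) *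
            (1 + PowerSeries.X) ^ i.val := by
  rw [PowerSeries.coeff_C_mul, PowerSeries.coeff_map, frobUnitBall_pow_apply]
  exact amiceProd_frobPow p d hd E hE hdeg hσ₀ hθ (fun m => PowerSeries.coeff k (r m)) (fun j => PowerSeries.coeff k (G j))
    (fun m j => hG m k j) t m j

include hE hdeg hσ₀ in
/-- ★ **The Frobenius itself** (`t = 1`): `j ↦ C(1 + X)·G(j − 1)` is the transform of `((r_m)^{φ_m})_m`. [cite: deShalit1987, Ch. I §3.1, §3.8 (17)] -/
theorem seriesProd_amice_frob {θ : ∀ m, unitBall (E m)} (hθ : ∀ m, IsIntegralNormalGen (E m) (θ m))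
    (r : ∀ m, PowerSeries (unitBall (E m))) (G : ZMod d → PowerSeries (PowerSeries 𝒪[F]))
    (hG : ∀ m k (j : ZMod d), ((1 + PowerSeries.X : PowerSeries 𝒪[F]) ^ p ^ m - 1) ∣
      PowerSeries.coeff k (G j) - ∑ i : ZMod (p ^ m), PowerSeries.C ((hθ m).basis.repr (PowerSeries.coeff k (r m))
        (((absoluteGaloisGroup.toAlgEquiv F σ₀).restrictNormal (E m)) ^ ((ZMod.chineseRemainder (hd.pow_right m)).symm (j, i)).val)) *
          (1 + PowerSeries.X) ^ i.val) (m k : ℕ) (j : ZMod d) :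
    ((1 + PowerSeries.X : PowerSeries 𝒪[F]) ^ p ^ m - 1) ∣
      PowerSeries.coeff k (PowerSeries.C (1 + PowerSeries.X : PowerSeries 𝒪[F]) * G (j - 1)) -
        ∑ i : ZMod (p ^ m), PowerSeries.C ((hθ m).basis.repr
          (PowerSeries.coeff k (PowerSeries.map (frobUnitBall (E m) σ₀ : unitBall (E m) →+* unitBall (E m)) (r m)))
          (((absoluteGaloisGroup.toAlgEquiv F σ₀).restrictNormal (E m)) ^ ((ZMod.chineseRemainder (hd.pow_right m)).symm (j, i)).val)) *
            (1 + PowerSeries.X) ^ i.val := by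
  have h := seriesProd_amice_frobPow p d hd E hE hdeg hσ₀ hθ r G hG 1 m k j
  rw [pow_one, pow_one, Nat.cast_one] at h
  exact h

end TwoVariableTransformCyclicTwo

end Literature.NumberTheory.GaloisRepresentations
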